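import Mathlib
import Literature.NumberTheory.NumberFields.PureCubicClassNumberModThreeProofs

/-!
# Crux `LinnikCubicClassGroups.PureCubicClassNumberHard` (stmt-QuantumAdvantage-11826) —
# stub `stub_setupExists`

Line `Sketch` (honda-leak arm), stub `stub_setupExists` (S): the ambient field of the genus-theory
argument for `3 ∤ h(ℚ(∛(pq)))`.  For distinct primes `p, q` there is a Galois number field `N` of
degree `6` — a splitting field of `f = X³ − pq` over `ℚ` — containing `ζ` with `ζ² + ζ + 1 = 0`
and `θ = ∛(pq)`, together with an automorphism `σ` of order dividing `3` with `σ ζ = ζ`,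
`σ θ = ζ θ`, into which every cubic number field containing a cube root of `pq` embeds.

* `N`: `f.SplittingField` (its `ℚ`-algebra structure identified with the canonical one), `f`
  irreducible (`Honda1971.irreducible_X_pow_three_sub_C`) hence separable with three distinct
  roots; `θ ≠ θ₂` two of them, `ζ := θ₂ / θ` (`ζ³ = 1`, `ζ ≠ 1`);
* `[N : ℚ] = 6`: `Gal(N/ℚ) ↪ 𝔖(roots)` gives `≤ 3! = 6`, and `[ℚ(θ) : ℚ] = 3`, `[ℚ(ζ) : ℚ] = 2`
  (`minpoly ζ = Φ₃`) divide `[N : ℚ]`;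
* `σ`: a nontrivial element `τ` of `Gal(N/ℚ(ζ))` (order `3`) moves `θ` (an element fixing `ℚ(θ)`
  has order dividing `2`) to another cube root `u θ` of `pq`, `u³ = 1`, `u ≠ 1`, so `u ∈ {ζ, ζ²}`;
  `σ := τ` or `τ²` accordingly;
* embeddings: `K = ℚ(α)` with `minpoly α = f` (`Honda1971.adjoin_eq_top`, `Honda1971.minpoly_eq`)
  and `f` splits in `N` (`IntermediateField.nonempty_algHom_of_adjoin_splits`).
-/

set_option linter.dupNamespace false

namespace Summit.QuantumAdvantage.QuantumAdvantage.Theorems.LinnikCubicClassGroups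

open Polynomial NumberField Module Literature.NumberTheory.NumberFields
open scoped IntermediateField

/-- The cube roots of unity in a field containing a primitive one `ζ` (`ζ² + ζ + 1 = 0`) are
`1, ζ, ζ²`: `u³ − 1 = (u − 1)(u − ζ)(u − ζ²)`. [folklore] -/
theorem setup_eq_of_pow_three_eq_one {R : Type*} [Field R] {ζ u : R} (hζ : ζ ^ 2 + ζ + 1 = 0)
    (hu : u ^ 3 = 1) : u = 1 ∨ u = ζ ∨ u = ζ ^ 2 := by
  have h : (u - 1) * ((u - ζ) * (u - ζ ^ 2)) = 0 := by
    linear_combination (u - 1) * (ζ - 1 - u) * hζ + hu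
  rcases mul_eq_zero.mp h with h | h
  · exact Or.inl (sub_eq_zero.mp h)
  · rcases mul_eq_zero.mp h with h | h
    · exact Or.inr (Or.inl (sub_eq_zero.mp h))
    · exact Or.inr (Or.inr (sub_eq_zero.mp h))

/-- An automorphism fixing `a` fixes `F⟮a⟯` pointwise. [folklore] -/
theorem setup_mem_fixingSubgroup_adjoin_simple {F E : Type*} [Field F] [Field E] [Algebra F E]
    {τ : E ≃ₐ[F] E} {a : E} (h : τ a = a) : τ ∈ F⟮a⟯.fixingSubgroup := by
  rw [IntermediateField.mem_fixingSubgroup_iff]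
  intro x hx
  induction hx using IntermediateField.adjoin_induction with
  | mem x hx =>
    rw [Set.mem_singleton_iff] at hx
    rw [hx, h]
  | algebraMap x => exact τ.commutes x
  | add x y _ _ hx hy => rw [map_add, hx, hy]
  | inv x _ hx => rw [map_inv₀, hx]
  | mul x y _ _ hx hy => rw [map_mul, hx, hy]

/-- **The setup on an arbitrary splitting field.**  Let `p ≠ q` be primes, `f = X³ − pq`, and
`M` a number field which is a splitting field of `f` over `ℚ`.  Then `[M : ℚ] = 6` and there are
`ζ, θ ∈ M`, `σ ∈ Gal(M/ℚ)` with `ζ² + ζ + 1 = 0`, `θ³ = pq`, `σ ζ = ζ`, `σ θ = ζ θ`, `σ³ = 1`, and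
every cubic number field containing a cube root of `pq` embeds into `M`. [folklore] -/
theorem setup_of_isSplittingField {p q : ℕ} (hp : p.Prime) (hq : q.Prime) (hpq : p ≠ q)
    {f : ℚ[X]} (hfdef : f = X ^ 3 - C ((p * q : ℕ) : ℚ)) (M : Type*) [Field M] [NumberField M]
    [IsSplittingField ℚ M f] :
    Module.finrank ℚ M = 6 ∧
      ∃ (ζ θ : M) (σ : M ≃ₐ[ℚ] M), ζ ^ 2 + ζ + 1 = 0 ∧ θ ^ 3 = ((p * q : ℕ) : M) ∧
        σ ζ = ζ ∧ σ θ = ζ * θ ∧ (∀ x : M, σ (σ (σ x)) = x) ∧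
        ∀ (K : Type) [Field K] [NumberField K], Module.finrank ℚ K = 3 →
          (∃ α : K, α ^ 3 = ((p * q : ℕ) : K)) → Nonempty (K →ₐ[ℚ] M) := by
  classical
  have hirr : Irreducible f := hfdef ▸ Honda1971.irreducible_X_pow_three_sub_C hp hq hpq
  have hmonic : f.Monic := hfdef ▸ monic_X_pow_sub_C _ (by norm_num)
  have hdeg : f.natDegree = 3 := by rw [hfdef, natDegree_X_pow_sub_C]
  have hsep : f.Separable := hirr.separable
  haveI : IsGalois ℚ M := IsGalois.of_separable_splitting_field hsep
  have hsplit : (f.map (algebraMap ℚ M)).Splits := IsSplittingField.splits M f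
  -- (1) two distinct roots `θ ≠ θ₂` of `f`, `ζ := θ₂ / θ`
  have hcard : Fintype.card (f.rootSet M) = 3 := by
    rw [card_rootSet_eq_natDegree hsep hsplit, hdeg]
  obtain ⟨⟨θ, hθmem⟩, ⟨θ₂, hθ₂mem⟩, hne⟩ :=
    Fintype.exists_pair_of_one_lt_card (α := f.rootSet M) (by omega)
  have hroot : ∀ x ∈ f.rootSet M, x ^ 3 = ((p * q : ℕ) : M) := by
    intro x hx
    have h := (mem_rootSet.mp hx).2
    rw [hfdef] at h
    simp only [map_natCast, aeval_sub, map_pow, aeval_X] at h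
    exact sub_eq_zero.mp h
  have hθ : θ ^ 3 = ((p * q : ℕ) : M) := hroot θ hθmem
  have hθ₂ : θ₂ ^ 3 = ((p * q : ℕ) : M) := hroot θ₂ hθ₂mem
  have hne' : θ ≠ θ₂ := fun h => hne (Subtype.ext h)
  have hpq0 : ((p * q : ℕ) : M) ≠ 0 := by exact_mod_cast Nat.mul_ne_zero hp.ne_zero hq.ne_zero
  have hθ0 : θ ≠ 0 := by
    rintro rfl
    rw [zero_pow (by norm_num)] at hθ
    exact hpq0 hθ.symm
  set ζ : M := θ₂ / θ with hζdef
  have hζθ : ζ * θ = θ₂ := div_mul_cancel₀ θ₂ hθ0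
  have hζ3 : ζ ^ 3 = 1 := by rw [hζdef, div_pow, hθ, hθ₂, div_self hpq0]
  have hζ1 : ζ ≠ 1 := by
    intro h
    rw [h, one_mul] at hζθ
    exact hne' hζθ
  have hζ : ζ ^ 2 + ζ + 1 = 0 := by
    have h : (ζ - 1) * (ζ ^ 2 + ζ + 1) = 0 := by linear_combination hζ3
    rcases mul_eq_zero.mp h with h | h
    · exact absurd (sub_eq_zero.mp h) hζ1
    · exact h
  -- (2) degrees: `[ℚ(θ) : ℚ] = 3`, `[ℚ(ζ) : ℚ] = 2`, `[M : ℚ] ≤ 3! = 6`, so `[M : ℚ] = 6`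
  have hθint : IsIntegral ℚ θ := .of_finite ℚ θ
  have hζint : IsIntegral ℚ ζ := .of_finite ℚ ζ
  have hminθ : minpoly ℚ θ = f := by
    refine (minpoly.eq_of_irreducible_of_monic hirr ?_ hmonic).symm
    rw [hfdef]
    simp only [map_natCast, aeval_sub, map_pow, aeval_X, hθ, sub_self]
  have hminζ : minpoly ℚ ζ = cyclotomic 3 ℚ := by
    refine (minpoly.eq_of_irreducible_of_monic (cyclotomic.irreducible_rat (by norm_num)) ?_
      (cyclotomic.monic 3 ℚ)).symm
    rw [cyclotomic_three]
    simp only [map_add, map_pow, aeval_X, map_one]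
    exact hζ
  have hdθ : finrank ℚ ℚ⟮θ⟯ = 3 := by
    rw [IntermediateField.adjoin.finrank hθint, hminθ, hdeg]
  have hdζ : finrank ℚ ℚ⟮ζ⟯ = 2 := by
    rw [IntermediateField.adjoin.finrank hζint, hminζ, natDegree_cyclotomic,
      Nat.totient_prime Nat.prime_three]
  have htowerθ := Module.finrank_mul_finrank ℚ ℚ⟮θ⟯ M
  have htowerζ := Module.finrank_mul_finrank ℚ ℚ⟮ζ⟯ M
  rw [hdθ] at htowerθ
  rw [hdζ] at htowerζ
  have hpos : 0 < finrank ℚ M := finrank_pos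
  haveI : Fact ((f.map (algebraMap ℚ M)).Splits) := ⟨hsplit⟩
  have hcard' : Nat.card (f.rootSet M) = 3 := by rw [Nat.card_eq_fintype_card, hcard]
  have hle : finrank ℚ M ≤ 6 := by
    rw [(IsSplittingField.algEquiv M f).toLinearEquiv.finrank_eq, ← Gal.card_of_separable hsep]
    calc Nat.card f.Gal ≤ Nat.card (Equiv.Perm (f.rootSet M)) :=
          Nat.card_le_card_of_injective _ (Gal.galActionHom_injective f M)
      _ = 6 := by rw [Nat.card_perm, hcard']; rfl
  have h6 : finrank ℚ M = 6 := by omega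
  have ha : finrank ℚ⟮ζ⟯ M = 3 := by omega
  have hb : finrank ℚ⟮θ⟯ M = 2 := by omega
  -- (3) embeddings of the cubic fields `K = ℚ(α)`, `α³ = pq`
  have hemb : ∀ (K : Type) [Field K] [NumberField K], Module.finrank ℚ K = 3 →
      (∃ α : K, α ^ 3 = ((p * q : ℕ) : K)) → Nonempty (K →ₐ[ℚ] M) := by
    intro K _ _ h3 hα
    obtain ⟨α, hα⟩ := hα
    have hαint : IsIntegral ℚ α := .of_finite ℚ α
    have hminα : minpoly ℚ α = f := by rw [hfdef]; exact Honda1971.minpoly_eq hp hq hpq hα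
    refine IntermediateField.nonempty_algHom_of_adjoin_splits (S := {α}) (fun s hs => ?_)
      (Honda1971.adjoin_eq_top hp hq hpq h3 hα)
    rw [Set.mem_singleton_iff] at hs
    subst hs
    exact ⟨hαint, hminα ▸ hsplit⟩
  -- (4) a generator `τ` of `Gal(M/ℚ(ζ))` (order `3`), moving `θ`
  have hH : Nat.card ℚ⟮ζ⟯.fixingSubgroup = 3 := by
    rw [IsGalois.card_fixingSubgroup_eq_finrank, ha]
  have hH' : Nat.card ℚ⟮θ⟯.fixingSubgroup = 2 := by
    rw [IsGalois.card_fixingSubgroup_eq_finrank, hb]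
  have hHne : ℚ⟮ζ⟯.fixingSubgroup ≠ ⊥ := by
    intro h
    rw [Subgroup.eq_bot_iff_card] at h
    omega
  obtain ⟨⟨τ, hτH⟩, hτ1⟩ := Subgroup.ne_bot_iff_exists_ne_one.mp hHne
  have hτ1' : τ ≠ 1 := fun h => hτ1 (Subtype.ext h)
  have hτ3 : τ ^ 3 = 1 := by
    have h := pow_card_eq_one' (x := (⟨τ, hτH⟩ : ℚ⟮ζ⟯.fixingSubgroup))
    rw [hH] at h
    exact congrArg Subtype.val h
  have hτζ : τ ζ = ζ :=
    (IntermediateField.mem_fixingSubgroup_iff _ _).mp hτH ζ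
      (IntermediateField.mem_adjoin_simple_self ℚ ζ)
  have hτθ : τ θ ≠ θ := by
    intro h
    have hτH' : τ ∈ ℚ⟮θ⟯.fixingSubgroup := setup_mem_fixingSubgroup_adjoin_simple h
    have h2 : τ ^ 2 = 1 := by
      have h := pow_card_eq_one' (x := (⟨τ, hτH'⟩ : ℚ⟮θ⟯.fixingSubgroup))
      rw [hH'] at h
      exact congrArg Subtype.val h
    apply hτ1'
    calc τ = τ ^ 3 * (τ ^ 2)⁻¹ := by group
      _ = 1 := by rw [hτ3, h2]; group
  have hτ3x : ∀ x : M, τ (τ (τ x)) = x := fun x => by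
    have h := congrArg (fun φ : M ≃ₐ[ℚ] M => φ x) hτ3
    simpa only [pow_succ, pow_zero, one_mul, AlgEquiv.mul_apply, AlgEquiv.one_apply] using h
  -- (5) `τ θ = u θ` with `u³ = 1`, `u ≠ 1`: `σ := τ` if `u = ζ`, `σ := τ²` if `u = ζ²`
  have hu3 : (τ θ / θ) ^ 3 = 1 := by rw [div_pow, ← map_pow, hθ, map_natCast, div_self hpq0]
  have huθ : τ θ / θ * θ = τ θ := div_mul_cancel₀ _ hθ0
  rcases setup_eq_of_pow_three_eq_one hζ hu3 with hu | hu | hu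
  · exact absurd (by rw [← huθ, hu, one_mul]) hτθ
  · have hτθ' : τ θ = ζ * θ := by rw [← huθ, hu]
    exact ⟨h6, ζ, θ, τ, hζ, hθ, hτζ, hτθ', hτ3x, hemb⟩
  · have hτθ' : τ θ = ζ ^ 2 * θ := by rw [← huθ, hu]
    refine ⟨h6, ζ, θ, τ ^ 2, hζ, hθ, ?_, ?_, fun x => ?_, hemb⟩
    · rw [pow_two, AlgEquiv.mul_apply, hτζ, hτζ]
    · rw [pow_two, AlgEquiv.mul_apply, hτθ', map_mul, map_pow, hτζ, hτθ']
      linear_combination ζ * θ * hζ3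
    · simp only [pow_two, AlgEquiv.mul_apply]
      rw [hτ3x, hτ3x]

/-- **Stub `stub_setupExists`** (line `Sketch`, honda-leak arm): the ambient field.  For distinct
primes `p, q` there is a Galois number field `N` of degree `6` (a splitting field of `X³ − pq`)
with `ζ` (`ζ² + ζ + 1 = 0`), `θ = ∛(pq)` and an automorphism `σ` with `σ ζ = ζ`, `σ θ = ζ θ`,
`σ³ = 1`, into which every cubic number field containing a cube root of `pq` embeds. [folklore] -/
theorem stub_setupExists (p q : ℕ) (hp : p.Prime) (hq : q.Prime) (hpq : p ≠ q) :
    ∃ (N : Type) (_ : Field N) (_ : NumberField N), IsGalois ℚ N ∧ Module.finrank ℚ N = 6 ∧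
      ∃ (ζ θ : N) (σ : N ≃ₐ[ℚ] N), ζ ^ 2 + ζ + 1 = 0 ∧ θ ^ 3 = ((p * q : ℕ) : N) ∧
        σ ζ = ζ ∧ σ θ = ζ * θ ∧ (∀ x : N, σ (σ (σ x)) = x) ∧
        ∀ (K : Type) [Field K] [NumberField K], Module.finrank ℚ K = 3 →
          (∃ α : K, α ^ 3 = ((p * q : ℕ) : K)) → Nonempty (K →ₐ[ℚ] N) := by
  obtain ⟨f, hfdef⟩ : ∃ f : ℚ[X], f = X ^ 3 - C ((p * q : ℕ) : ℚ) := ⟨_, rfl⟩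
  -- the splitting field, with its `ℚ`-algebra structure identified with the canonical one
  obtain ⟨M, _instF, _instNF, _instG, _instS⟩ :
      ∃ (M : Type) (_ : Field M) (_ : NumberField M) (_ : IsGalois ℚ M),
        IsSplittingField ℚ M f := by
    obtain ⟨instA, hS, hFD, hNo⟩ : ∃ inst : Algebra ℚ f.SplittingField,
        @IsSplittingField ℚ f.SplittingField _ _ inst f ∧
        @FiniteDimensional ℚ f.SplittingField _ _ inst.toModule ∧
        @Normal ℚ f.SplittingField _ _ inst :=
      ⟨_, Polynomial.IsSplittingField.splittingField f,
        IsSplittingField.finiteDimensional _ f, SplittingField.instNormal f⟩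
    have hinst : instA = DivisionRing.toRatAlgebra := Subsingleton.elim _ _
    subst hinst
    haveI hN : NumberField f.SplittingField :=
      @NumberField.mk _ _ (SplittingField.instCharZero f) hFD
    haveI hG : IsGalois ℚ f.SplittingField :=
      { to_isSeparable := inferInstance, to_normal := hNo }
    exact ⟨f.SplittingField, inferInstance, hN, hG, hS⟩
  obtain ⟨h6, ζ, θ, σ, h⟩ := setup_of_isSplittingField hp hq hpq hfdef M
  exact ⟨M, _instF, _instNF, _instG, h6, ζ, θ, σ, h⟩

end Summit.QuantumAdvantage.QuantumAdvantage.Theorems.LinnikCubicClassGroups
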